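import Summits.AtomisticToContinuum.HydrodynamicLimit.Theorems.MourreKoopmanChargesLinearToEntropyInBandStressRungPrep
import Summits.AtomisticToContinuum.HydrodynamicLimit.Theorems.OneFlightGossipEngineEquilibriumHeatFluxVarianceDecayCorrelations
import Summits.AtomisticToContinuum.HydrodynamicLimit.Theorems.TwoClocksTransferEntropyClockTailRateCutoff
import Summits.AtomisticToContinuum.HydrodynamicLimit.Theorems.KineticWindowGronwall.Negative.ActivityDummy
import HarnessLib

/-!
# `OneBodyCompleteness → EquilibriumHeatFluxVarianceDecay`: the kinetic HEAT-FLUX linear rung of the crux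
# `LinearToEntropyInBand` (stmt-AtomisticToContinuum-17740), route `MourreKoopmanCharges`

Support file (`--supports stmt-AtomisticToContinuum-17740`, registered stub `stub_kineticHeatFluxLinearRung`) of the
line `registered`, skeleton v4 (lead prover-line-…-17740-c3-0).  Heat-flux twin of
`Theorems/MourreKoopmanChargesLinearToEntropyInBandStressRung.lean`: the route's typed crux `OneBodyCompleteness`
(stmt-9583, zero Euler-window Drude weight in Cesàro form) implies rung C4 of route OneFlightGossipEngine,
`EquilibriumHeatFluxVarianceDecay` (stmt-9532: `lim_{τ→∞} limsup_N (N+1)·E_{λ^N}[Ȳ_τ²] = 0` for the window-averaged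
per-particle FAST kinetic heat flux `φ(x)(v⁰|v|² − 5θ₀v⁰)` under the centred canonical Gibbs law), so that BOTH
kinetic rows of flux-Gibbsianity (shear stress and heat flux) hold at the first-order (`L²`, Green–Kubo) level under
the bridge's first hypothesis.

* `heatFlux_item_term_eq_fejer` — the Green–Kubo / Fejér form of the item's functional for the heat flux
  (`ae_windowSum_eq` + the general `lintegral_sq_windowAvg_eq_fejer`): `(N+1)∫⁻ ofReal(Ȳ_h²) dλ =
  ofReal((N+1)·2h⁻²∫₀ʰ(h−t)C_N(t)dt)`, `C_N(t) = ∫ 𝐘 · 𝐘∘Φ_t dλ`;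
* the fast heat flux `h_θ(v) = v⁰|v|² − 5θv⁰` is an ADMISSIBLE `h` for `OneBodyCompleteness`: continuous
  (`continuous_hf`), `|h_θ v| ≤ (1 + 5|θ|)(1 + ‖v‖)³`, Maxwellian-orthogonal to `1`, `|v|²` and `vᵢ` (`i ≠ 0`) by
  oddness under coordinate reflections, and to `v⁰` by the Gaussian moment identity `E_γ[ξ₀²(|ξ|² − 5)] = 0`
  (`TransferEntropyClockTailRateCutoff.integral_coord_sq_mul_norm_sq_sub_five`) after standardisation — this is
  exactly why `5θ v⁰` is subtracted;
* `stub_kineticHeatFluxLinearRung : OneBodyCompleteness → EquilibriumHeatFluxVarianceDecay` — identification of the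
  `OneBodyCompleteness` correlation with `(N+1)C_N(s(N+1)^{-1/3})`, the `N`-uniform bound `(N+1)|C_N| ≤ K²m₂(θ)`
  (`abs_corr_le_integral_sq`, `lintegral_Yobs_sq_le`), Fejér from Cesàro (`fejer_le_of_cesaro`), change of variables
  and the activity dummy.

References: H. Spohn, *Large Scale Dynamics of Interacting Particles* (1991), Part I §7.1, Part II §1.7.
-/

noncomputable section

namespace Summit.AtomisticToContinuum.HydrodynamicLimit.Theorems.LTEInBand

open MeasureTheory ProbabilityTheory Filter Topology Set
open Literature.Analysis.FluidPDE Literature.MathematicalPhysics.KineticTheory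
open scoped InnerProductSpace ENNReal Interval
open Summit.AtomisticToContinuum.HydrodynamicLimit.Theorems
open BoltzmannGreenKuboOrthMomentum BoltzmannGreenKuboForallN EquilibriumStressVarianceDecayC3
open OneFlightGossipEngineHeatFlux
open Summit.AtomisticToContinuum.HydrodynamicLimit.Theses

/-! ## § 1 The Fejér form of the heat-flux item -/

section Fejer

variable {a₀ θ₀ σ : ℝ} {N : ℕ}

/-- **Green–Kubo / Fejér form of the heat-flux item's functional** (every `N`, flow, window `h > 0`):
`(N+1)·∫⁻ ofReal(((N+1)⁻¹ Σᵢ h⁻¹∫₀ʰ φ(xᵢ(r)) h_θ₀(vᵢ(r)) dr)²) dλ = ofReal((N+1)·2h⁻²∫₀ʰ(h − t)C_N(t)dt)` with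
`C_N(t) = ∫ 𝐘 · 𝐘∘Φ_t dλ`. [folklore] -/
theorem heatFlux_item_term_eq_fejer (ha : 0 < a₀) (hθ : 0 < θ₀) (hσ : σ ≤ 1 / 2) (N : ℕ)
    (Φ : HardSphereFlow (Torus.geometry (Fin 3)) (hsDiameter σ N) (N + 1))
    {φ : T3 → ℝ} (hφ : Continuous φ) {K : ℝ} (hK : ∀ x, |φ x| ≤ K) {h : ℝ} (hh : 0 < h) :
    ((N : ℝ≥0∞) + 1) * ∫⁻ z, ENNReal.ofReal ((((N : ℝ) + 1)⁻¹ * ∑ i : Fin (N + 1),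
        (h⁻¹ * ∫ r in (0 : ℝ)..h, φ ((Φ.flow r z i).1) * 𝐡[θ₀, (Φ.flow r z i).2])) ^ 2)
        ∂(localGibbsLaw σ (fun _ => a₀) (fun _ => 0) (fun _ => θ₀) N Φ) =
      ENNReal.ofReal (((N : ℝ) + 1) * (2 * h⁻¹ ^ 2 * ∫ t in (0 : ℝ)..h, (h - t) *
        ∫ z, 𝐘[N, θ₀, φ, z] * 𝐘[N, θ₀, φ, Φ.flow t z] ∂(localGibbsLaw σ (fun _ => a₀) (fun _ => 0) (fun _ => θ₀) N Φ))) := by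
  haveI : IsProbabilityMeasure (localGibbsLaw σ (fun _ => a₀) (fun _ => (0 : V3)) (fun _ => θ₀) N Φ) :=
    isProbabilityMeasure_localGibbsLaw continuous_const continuous_const continuous_const
      (fun _ => ha) (fun _ => hθ) hσ N Φ
  set G := localGibbsLaw σ (fun _ => a₀) (fun _ => (0 : V3)) (fun _ => θ₀) N Φ with hGdef
  have e : ∫⁻ z, ENNReal.ofReal ((((N : ℝ) + 1)⁻¹ * ∑ i : Fin (N + 1),
        (h⁻¹ * ∫ r in (0 : ℝ)..h, φ ((Φ.flow r z i).1) * 𝐡[θ₀, (Φ.flow r z i).2])) ^ 2) ∂G =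
      ∫⁻ z, ENNReal.ofReal ((h⁻¹ * ∫ r in (0 : ℝ)..h, 𝐘[N, θ₀, φ, Φ.flow r z]) ^ 2) ∂G := by
    refine lintegral_congr_ae ?_
    filter_upwards [ae_windowSum_eq ha hθ hσ N Φ hφ hK hh.le] with z hz
    rw [hz]
  have hcast : ((N : ℝ≥0∞) + 1) = ENNReal.ofReal ((N : ℝ) + 1) := by
    rw [ENNReal.ofReal_add (Nat.cast_nonneg N) zero_le_one, ENNReal.ofReal_natCast, ENNReal.ofReal_one]
  rw [e, lintegral_sq_windowAvg_eq_fejer a₀ θ₀ 0 Φ (measurable_Yobs θ₀ hφ) (memLp_two_Yobs ha hθ hσ N Φ hφ hK) hh,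
    hcast, ← ENNReal.ofReal_mul (by positivity)]

/-- **`N`-uniform static bound of the heat-flux autocorrelation**: `(N+1)|C_N(t)| ≤ K² m₂(θ₀)`. [folklore] -/
theorem succ_mul_abs_heatFluxCorr_le (ha : 0 < a₀) (hθ : 0 < θ₀) (hσ : σ ≤ 1 / 2) (N : ℕ)
    (Φ : HardSphereFlow (Torus.geometry (Fin 3)) (hsDiameter σ N) (N + 1))
    {φ : T3 → ℝ} (hφ : Continuous φ) {K : ℝ} (hK : ∀ x, |φ x| ≤ K) (t : ℝ) :
    ((N : ℝ) + 1) * |∫ z, 𝐘[N, θ₀, φ, z] * 𝐘[N, θ₀, φ, Φ.flow t z]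
        ∂(localGibbsLaw σ (fun _ => a₀) (fun _ => 0) (fun _ => θ₀) N Φ)| ≤ K ^ 2 * 𝐦₂[θ₀] := by
  set G := localGibbsLaw σ (fun _ => a₀) (fun _ => (0 : V3)) (fun _ => θ₀) N Φ with hGdef
  have hNpos : (0 : ℝ) < (N : ℝ) + 1 := by positivity
  have hcorr := OneFlightGossipEngineHeatFlux.abs_corr_le_integral_sq ha hθ hσ N Φ hφ hK t
  have hsq : ∫ z, 𝐘[N, θ₀, φ, z] ^ 2 ∂G ≤ ((N : ℝ) + 1)⁻¹ * (K ^ 2 * 𝐦₂[θ₀]) := by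
    have hnn : 0 ≤ ((N : ℝ) + 1)⁻¹ * (K ^ 2 * 𝐦₂[θ₀]) := by
      have := m2_nonneg θ₀; positivity
    rw [integral_eq_lintegral_of_nonneg_ae (Eventually.of_forall fun z => sq_nonneg _)
      ((measurable_Yobs θ₀ hφ).pow_const 2).aestronglyMeasurable]
    refine (ENNReal.toReal_mono ENNReal.ofReal_ne_top (lintegral_Yobs_sq_le ha hθ hσ N Φ hφ hK)).trans ?_
    rw [ENNReal.toReal_ofReal hnn]
  calc ((N : ℝ) + 1) * |∫ z, 𝐘[N, θ₀, φ, z] * 𝐘[N, θ₀, φ, Φ.flow t z] ∂G|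
      ≤ ((N : ℝ) + 1) * (((N : ℝ) + 1)⁻¹ * (K ^ 2 * 𝐦₂[θ₀])) := mul_le_mul_of_nonneg_left (hcorr.trans hsq) hNpos.le
    _ = K ^ 2 * 𝐦₂[θ₀] := by field_simp

end Fejer

/-! ## § 2 The fast heat flux is an admissible `h` for `OneBodyCompleteness` -/

section Admissible

/-- Polynomial growth of order `3`: `|h_θ(v)| ≤ (1 + 5|θ|)(1 + ‖v‖)³`. [folklore] -/
theorem abs_hf_le_poly (θ : ℝ) (v : V3) : |𝐡[θ, v]| ≤ (1 + 5 * |θ|) * (1 + ‖v‖) ^ 3 := by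
  have h := abs_hf_le θ v
  have hn := norm_nonneg v
  have hθ := abs_nonneg θ
  have h1 : ‖v‖ ^ 3 ≤ (1 + ‖v‖) ^ 3 := by gcongr; linarith
  have h2 : ‖v‖ ≤ (1 + ‖v‖) ^ 3 := by nlinarith [h1, pow_nonneg hn 3]
  nlinarith [mul_le_mul_of_nonneg_left h2 (by positivity : (0 : ℝ) ≤ 5 * |θ|), pow_nonneg (by linarith : (0:ℝ) ≤ 1 + ‖v‖) 3]

/-- `h_θ` is odd under `v⁰ ↦ −v⁰`. [folklore] -/
theorem hf_reflB_zero (θ : ℝ) (v : V3) : 𝐡[θ, reflB 0 v] = -𝐡[θ, v] := by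
  rw [LinearIsometryEquiv.norm_map]
  simp [reflB_apply]
  ring

/-- `h_θ` is even under `vⁱ ↦ −vⁱ` for `i ≠ 0`. [folklore] -/
theorem hf_reflB_of_ne (θ : ℝ) {i : Fin 3} (hi : i ≠ 0) (v : V3) : 𝐡[θ, reflB i v] = 𝐡[θ, v] := by
  rw [LinearIsometryEquiv.norm_map]
  simp [reflB_apply, hi.symm]

/-- `h_θ ⊥ 1` in `L²(M_{1,θ,0})`. [folklore] -/
theorem hf_orth_one {θ : ℝ} (hθ : 0 < θ) :
    ∫ v, (fun v : V3 => 𝐡[θ, v]) v * localMaxwellian 1 θ (0 : V3) v = 0 :=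
  integral_mul_localMaxwellian_eq_zero_of_odd hθ 0 fun v => hf_reflB_zero θ v

/-- `h_θ ⊥ |v|²` in `L²(M_{1,θ,0})`. [folklore] -/
theorem hf_orth_norm_sq {θ : ℝ} (hθ : 0 < θ) :
    ∫ v, (fun v : V3 => 𝐡[θ, v]) v * ‖v‖ ^ 2 * localMaxwellian 1 θ (0 : V3) v = 0 := by
  refine integral_mul_localMaxwellian_eq_zero_of_odd hθ 0 (ψ := fun v => (fun v : V3 => 𝐡[θ, v]) v * ‖v‖ ^ 2)
    fun v => ?_
  dsimp only
  rw [hf_reflB_zero, LinearIsometryEquiv.norm_map]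
  ring

/-- **`h_θ ⊥ v⁰` in `L²(M_{1,θ,0})` — the Euler orthogonality that fixes the coefficient `5θ`**:
`∫ h_θ(v) v⁰ M_{1,θ,0} dv = θ² ∫ ξ₀²(|ξ|² − 5) dγ(ξ) = 0` after standardisation `v = √θ ξ`. [folklore] -/
theorem hf_orth_coord_zero {θ : ℝ} (hθ : 0 < θ) :
    ∫ v, (fun v : V3 => 𝐡[θ, v]) v * v 0 * localMaxwellian 1 θ (0 : V3) v = 0 := by
  have e : (fun v : V3 => (fun v : V3 => 𝐡[θ, v]) v * v 0 * localMaxwellian 1 θ (0 : V3) v) =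
      fun v => ((fun v : V3 => 𝐡[θ, v]) v * v 0) * localMaxwellian 1 θ (0 : V3) v := by
    funext v; ring
  rw [e, ← ChaosClosesEulerMaxwellianMoments.integral_gaussMeasure_eq_integral_mul_localMaxwellian hθ 0,
    integral_gaussMeasure 0 hθ]
  have hr2 : Real.sqrt θ ^ 2 = θ := Real.sq_sqrt hθ.le
  have hpt : ∀ w : V3, (fun v : V3 => 𝐡[θ, v]) (0 + Real.sqrt θ • w) * (0 + Real.sqrt θ • w) 0 =
      θ ^ 2 * (w 0 * w 0 * (‖w‖ ^ 2 - 5)) := by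
    intro w
    dsimp only
    rw [zero_add, norm_smul, Real.norm_eq_abs, abs_of_nonneg (Real.sqrt_nonneg θ), PiLp.smul_apply, smul_eq_mul]
    have hr4 : Real.sqrt θ ^ 4 = θ ^ 2 := by
      rw [show (4 : ℕ) = 2 * 2 from rfl, pow_mul, hr2]
    have : Real.sqrt θ * w 0 * (Real.sqrt θ * ‖w‖) ^ 2 - 5 * θ * (Real.sqrt θ * w 0) =
        Real.sqrt θ * (θ * (w 0 * ‖w‖ ^ 2 - 5 * w 0)) := by
      rw [mul_pow, hr2]; ring
    rw [this]
    calc Real.sqrt θ * (θ * (w 0 * ‖w‖ ^ 2 - 5 * w 0)) * (Real.sqrt θ * w 0)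
        = Real.sqrt θ ^ 2 * θ * ((w 0 * ‖w‖ ^ 2 - 5 * w 0) * w 0) := by ring
      _ = θ ^ 2 * (w 0 * w 0 * (‖w‖ ^ 2 - 5)) := by rw [hr2]; ring
  simp_rw [hpt]
  rw [integral_const_mul, TransferEntropyClockTailRateCutoff.integral_coord_sq_mul_norm_sq_sub_five, mul_zero]

/-- `h_θ ⊥ vⁱ` in `L²(M_{1,θ,0})` for every `i` (`i = 0`: the moment identity; `i ≠ 0`: oddness under `vⁱ ↦ −vⁱ`).
[folklore] -/
theorem hf_orth_coord {θ : ℝ} (hθ : 0 < θ) (i : Fin 3) :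
    ∫ v, (fun v : V3 => 𝐡[θ, v]) v * v i * localMaxwellian 1 θ (0 : V3) v = 0 := by
  by_cases hi : i = 0
  · subst hi; exact hf_orth_coord_zero hθ
  · refine integral_mul_localMaxwellian_eq_zero_of_odd hθ i (ψ := fun v => (fun v : V3 => 𝐡[θ, v]) v * v i)
      fun v => ?_
    dsimp only
    rw [hf_reflB_of_ne θ hi, reflB_apply, if_pos rfl]
    ring

end Admissible

/-! ## § 3 The rung -/

section Rung

variable {σ : ℝ} {N : ℕ}

/-- The one-body field of `OneBodyCompleteness` at `h = h_θ` IS the empirical fast heat flux `𝐘`. [folklore] -/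
theorem integral_hf_empiricalMeasure (θ : ℝ) (φ : T3 → ℝ) (z : Config (N + 1) (Fin 3) T3) :
    ∫ y, φ y.1 * (fun v : V3 => 𝐡[θ, v]) y.2 ∂(empiricalMeasure z) = 𝐘[N, θ, φ, z] := by
  rw [integral_empiricalMeasure]
  push_cast
  rfl

/-- **Registered stub `stub_kineticHeatFluxLinearRung` of crux stmt-AtomisticToContinuum-17740 — THE KINETIC HEAT-FLUX
LINEAR RUNG OF THE BRIDGE: `OneBodyCompleteness → EquilibriumHeatFluxVarianceDecay`** (stmt-9583 ⟹ stmt-9532).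
[folklore] -/
theorem stub_kineticHeatFluxLinearRung : Summit.AtomisticToContinuum.HydrodynamicLimit.Theses.MourreKoopmanCharges.OneBodyCompleteness → Summit.AtomisticToContinuum.HydrodynamicLimit.Theses.OneFlightGossipEngine.EquilibriumHeatFluxVarianceDecay := by
  intro hOBC a₀ θ ha hθ
  obtain ⟨σ₁, hσ₁, H⟩ := hOBC
  refine ⟨min σ₁ (1 / 2), lt_min hσ₁ (by norm_num), fun σ hσ hσlt Φ φ hφ => ?_⟩
  have hσ₁' : σ < σ₁ := lt_of_lt_of_le hσlt (min_le_left _ _)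
  have hσhalf : σ ≤ 1 / 2 := (lt_of_lt_of_le hσlt (min_le_right _ _)).le
  obtain ⟨Kφ, -, hKφ⟩ := exists_forall_abs_le_of_continuous hφ
  -- work at unit activity (the activity is decorative at fixed particle number)
  simp_rw [KineticWindowGronwallNegative.localGibbsLaw_const_activity ha.ne']
  haveI hprob : ∀ N : ℕ, IsProbabilityMeasure (localGibbsLaw σ (fun _ => (1 : ℝ)) (fun _ => (0 : V3)) (fun _ => θ) N (Φ N)) :=
    fun N => isProbabilityMeasure_localGibbsLaw continuous_const continuous_const continuous_const
      (fun _ => one_pos) (fun _ => hθ) hσhalf N (Φ N)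
  -- notation
  set c : ℕ → ℝ := fun N => ((N : ℝ) + 1) ^ (-(1 / 3 : ℝ)) with hc
  have hcpos : ∀ N, 0 < c N := fun N => Real.rpow_pos_of_pos (by positivity) _
  set C : ℕ → ℝ → ℝ := fun N t => ∫ z, 𝐘[N, θ, φ, z] * 𝐘[N, θ, φ, (Φ N).flow t z]
    ∂(localGibbsLaw σ (fun _ => (1 : ℝ)) (fun _ => 0) (fun _ => θ) N (Φ N)) with hC
  set Kf : ℕ → ℝ → ℝ := fun N s => ((N : ℝ) + 1) * C N (s * c N) with hKf
  -- inputs of `fejer_le_of_cesaro`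
  have hKm : ∀ N, Measurable (Kf N) := by
    intro N
    have hm := measurable_corr 1 θ 0 (Φ N) (measurable_Yobs (N := N) θ hφ)
    exact (hm.comp (measurable_id.mul_const (c N))).const_mul _
  set B : ℝ := Kφ ^ 2 * 𝐦₂[θ] with hB
  have hB0 : 0 ≤ B := by have := m2_nonneg θ; positivity
  have hKB : ∀ N s, |Kf N s| ≤ B := by
    intro N s
    rw [hKf]
    dsimp only
    rw [abs_mul, abs_of_pos (by positivity : (0 : ℝ) < (N : ℝ) + 1)]
    exact succ_mul_abs_heatFluxCorr_le one_pos hθ hσhalf N (Φ N) hφ hKφ _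
  have hces : ∀ δ : ℝ, 0 < δ → ∃ S₀ : ℝ, 0 < S₀ ∧ ∀ S : ℝ, S₀ ≤ S → ∃ N₀ : ℕ, ∀ N : ℕ, N₀ ≤ N →
      |S⁻¹ * ∫ s in (0 : ℝ)..S, Kf N s| ≤ δ := by
    intro δ hδ
    obtain ⟨S₀, hS₀, hS⟩ := H σ hσ hσ₁' θ hθ (fun v : V3 => 𝐡[θ, v]) (continuous_hf θ)
      ⟨1 + 5 * |θ|, 3, abs_hf_le_poly θ⟩ (hf_orth_one hθ) (hf_orth_coord hθ) (hf_orth_norm_sq hθ) Φ φ hφ δ hδ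
    refine ⟨S₀, hS₀, fun S hSS => ?_⟩
    obtain ⟨N₀, hN₀⟩ := hS S hSS
    refine ⟨N₀, fun N hN => ?_⟩
    have key : (fun s : ℝ => ((N : ℝ) + 1) * ∫ z,
        (∫ y, φ y.1 * (fun v : V3 => 𝐡[θ, v]) y.2 ∂(empiricalMeasure ((Φ N).flow (s * ((N : ℝ) + 1) ^ (-(1 / 3 : ℝ))) z))) *
          (∫ y, φ y.1 * (fun v : V3 => 𝐡[θ, v]) y.2 ∂(empiricalMeasure z))
        ∂(localGibbsLaw σ (fun _ => (1 : ℝ)) (fun _ => 0) (fun _ => θ) N (Φ N))) = Kf N := by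
      funext s
      rw [hKf, hC]
      dsimp only
      congr 1
      refine integral_congr_ae (Eventually.of_forall fun z => ?_)
      dsimp only
      rw [integral_hf_empiricalMeasure, integral_hf_empiricalMeasure, mul_comm]
    have h := hN₀ N hN
    rw [key] at h
    exact h
  have hfejer := fejer_le_of_cesaro hKm hB0 hKB hces
  -- change of variables `t = s · c N` in the item's Fejér functional
  have hcv : ∀ N : ℕ, ∀ τ : ℝ, ((N : ℝ) + 1) * (2 * (τ * c N)⁻¹ ^ 2 *
      ∫ t in (0 : ℝ)..(τ * c N), (τ * c N - t) * C N t) = 2 * τ⁻¹ ^ 2 * ∫ s in (0 : ℝ)..τ, (τ - s) * Kf N s := by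
    intro N τ
    have hcN := (hcpos N).ne'
    have hsub : ∫ s in (0 : ℝ)..τ, (τ * c N - s * c N) * C N (s * c N) =
        (c N)⁻¹ * ∫ t in (0 * c N)..(τ * c N), (τ * c N - t) * C N t := by
      rw [← smul_eq_mul (c N)⁻¹, ← intervalIntegral.integral_comp_mul_right (fun t => (τ * c N - t) * C N t) hcN]
    rw [zero_mul] at hsub
    have hKint : ∫ s in (0 : ℝ)..τ, (τ - s) * Kf N s =
        ((N : ℝ) + 1) * (c N)⁻¹ * ∫ s in (0 : ℝ)..τ, (τ * c N - s * c N) * C N (s * c N) := by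
      rw [mul_assoc, ← intervalIntegral.integral_const_mul, ← intervalIntegral.integral_const_mul]
      refine intervalIntegral.integral_congr fun s _ => ?_
      simp only [hKf]
      field_simp
    rw [hKint, hsub]
    field_simp
  -- conclude
  rw [ENNReal.tendsto_nhds_zero]
  intro ε hε
  by_cases hεtop : ε = ⊤
  · exact Eventually.of_forall fun τ => hεtop ▸ le_top
  have hεr : 0 < ε.toReal := ENNReal.toReal_pos hε.ne' hεtop
  obtain ⟨T₀, hT₀, hT⟩ := hfejer ε.toReal hεr
  filter_upwards [eventually_ge_atTop T₀] with τ hτ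
  have hτpos : 0 < τ := hT₀.trans_le hτ
  obtain ⟨N₀, hN₀⟩ := hT τ hτ
  refine Filter.limsup_le_of_le (h := ?_)
  filter_upwards [eventually_ge_atTop N₀] with N hN
  rw [heatFlux_item_term_eq_fejer one_pos hθ hσhalf N (Φ N) hφ hKφ (mul_pos hτpos (hcpos N)), hcv N τ]
  calc ENNReal.ofReal (2 * τ⁻¹ ^ 2 * ∫ s in (0 : ℝ)..τ, (τ - s) * Kf N s)
      ≤ ENNReal.ofReal ε.toReal := ENNReal.ofReal_le_ofReal (hN₀ N hN)
    _ = ε := ENNReal.ofReal_toReal hεtop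

end Rung

end Summit.AtomisticToContinuum.HydrodynamicLimit.Theorems.LTEInBand

end
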